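import Summits.Ventures.CertifiedArithmetic.LowPrec.EnvelopesE2M1

/-!
# Exhaustive envelopes of the MIXED FP6 pair `E3M2 ∘ E2M3` delivered in `E3M2` under RNE

HONEST FRAMING (venture CertifiedArithmetic / cell `pub-lowprec`): certified error envelopes and
provably optimal rounding/accumulation schemes for low-precision formats under stated cost models;
every table by two implementations; no hardware or vendor claims.

NEW WORK of the venture: heterogeneous operands (`a : E3M2`, `b : E2M3`, 64 × 64 ordered pairs),
exact product / sum rounded into `E3M2` by `roundNE` (RNE, saturating). Kernel-checked
(`decide +kernel`) envelopes by exponent code of the rounded result, sharp in-range relative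
constants, and exact / overflow counts; implementation A/B counterpart: enum canary pair
`ocp_e3m2__ocp_e2m3`. Destination `E3M2`: sums below `1/2` are exact (E3M2 has the finer quantum `1/16`).
-/

namespace Summit.Ventures.CertifiedArithmetic

open Literature.ComputerArithmetic.FloatingPoint
open Literature.ComputerArithmetic.FloatingPoint.MiniFloat
open Literature.ComputerArithmetic.FloatingPoint.Format

/-- Heterogeneous envelope test: in range (destination `ψ`) implies `|fl_ψ(a ∘ b) - a ∘ b| ≤ env[E]`. -/
def envTestH {φ₁ φ₂ : Format} (ψ : Format) (op : ℚ → ℚ → ℚ) (env : List ℚ) (a : MiniFloat φ₁)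
    (b : MiniFloat φ₂) : Bool :=
  decide (|op a.toRat b.toRat| ≤ ψ.maxRat →
    |(roundNE ψ (op a.toRat b.toRat)).toRat - op a.toRat b.toRat|
      ≤ env.getD (roundNE ψ (op a.toRat b.toRat)).expCode 0)

/-- Heterogeneous relative test: in range and nonzero implies `|err| ≤ c·|t|`. -/
def relTestH {φ₁ φ₂ : Format} (ψ : Format) (op : ℚ → ℚ → ℚ) (c : ℚ) (a : MiniFloat φ₁)
    (b : MiniFloat φ₂) : Bool :=
  decide (|op a.toRat b.toRat| ≤ ψ.maxRat → op a.toRat b.toRat ≠ 0 →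
    |(roundNE ψ (op a.toRat b.toRat)).toRat - op a.toRat b.toRat| ≤ c * |op a.toRat b.toRat|)

/-- Number of heterogeneous ordered pairs passing a Boolean test. -/
def countPairsH (φ₁ φ₂ : Format) (P : MiniFloat φ₁ → MiniFloat φ₂ → Bool) : ℕ :=
  ((MiniFloat.all φ₁).map fun a => ((MiniFloat.all φ₂).filter fun b => P a b).length).sum

/-- `E3M2 · E2M3 → E3M2`, absolute envelope by result exponent code: `[1/32, 1/32, 1/16, 1/8, 1/4, 1/2, 1, 2]` (half the spacing of
each binade of `E3M2`), for in-range products. -/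
theorem E3M2_E2M3_mul_E3M2_abs_envelope (a : MiniFloat E3M2) (b : MiniFloat E2M3)
    (h : |a.toRat * b.toRat| ≤ E3M2.maxRat) :
    |(roundNE E3M2 (a.toRat * b.toRat)).toRat - a.toRat * b.toRat|
      ≤ ([1/32, 1/32, 1/16, 1/8, 1/4, 1/2, 1, 2] : List ℚ).getD (roundNE E3M2 (a.toRat * b.toRat)).expCode 0 := by
  have := forall₂_of_all_all (P := envTestH E3M2 (· * ·) [1/32, 1/32, 1/16, 1/8, 1/4, 1/2, 1, 2]) (by decide +kernel) a b
  exact of_decide_eq_true this h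

/-- `E3M2 + E2M3 → E3M2`, absolute envelope by result exponent code: `[0, 0, 1/16, 1/8, 1/4, 1/2, 1, 2]`. -/
theorem E3M2_E2M3_add_E3M2_abs_envelope (a : MiniFloat E3M2) (b : MiniFloat E2M3)
    (h : |a.toRat + b.toRat| ≤ E3M2.maxRat) :
    |(roundNE E3M2 (a.toRat + b.toRat)).toRat - (a.toRat + b.toRat)|
      ≤ ([0, 0, 1/16, 1/8, 1/4, 1/2, 1, 2] : List ℚ).getD (roundNE E3M2 (a.toRat + b.toRat)).expCode 0 := by
  have := forall₂_of_all_all (P := envTestH E3M2 (· + ·) [0, 0, 1/16, 1/8, 1/4, 1/2, 1, 2]) (by decide +kernel) a b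
  exact of_decide_eq_true this h

/-- `E3M2 + E2M3 → E3M2`, relative envelope in range: `|err| ≤ 1 / 9 · |a+b|` (`u/(1+u)` of `E3M2`, attained). -/
theorem E3M2_E2M3_add_E3M2_rel_envelope (a : MiniFloat E3M2) (b : MiniFloat E2M3)
    (h : |a.toRat + b.toRat| ≤ E3M2.maxRat) (h0 : a.toRat + b.toRat ≠ 0) :
    |(roundNE E3M2 (a.toRat + b.toRat)).toRat - (a.toRat + b.toRat)| ≤ 1 / 9 * |a.toRat + b.toRat| := by
  have := forall₂_of_all_all (P := relTestH E3M2 (· + ·) (1 / 9)) (by decide +kernel) a b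
  exact of_decide_eq_true this h h0

/-- `E3M2 ∘ E2M3 → E3M2` COUNTS over the 4096 ordered pairs: exact products / sums and overflowing
(`|t| > maxRat E3M2`) products / sums = (1212, 1380, 600, 76). -/
theorem E3M2_E2M3_E3M2_counts :
    countPairsH E3M2 E2M3 (fun a b => decide ((roundNE E3M2 (a.toRat * b.toRat)).toRat = a.toRat * b.toRat)) = 1212 ∧
    countPairsH E3M2 E2M3 (fun a b => decide ((roundNE E3M2 (a.toRat + b.toRat)).toRat = a.toRat + b.toRat)) = 1380 ∧
    countPairsH E3M2 E2M3 (fun a b => decide (E3M2.maxRat < |a.toRat * b.toRat|)) = 600 ∧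
    countPairsH E3M2 E2M3 (fun a b => decide (E3M2.maxRat < |a.toRat + b.toRat|)) = 76 := by
  decide +kernel

end Summit.Ventures.CertifiedArithmetic
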